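import Summits.HodgeConjecture.CorCM.GaloisCyclicSemidirectEightNormPairCoefficients
import Summits.HodgeConjecture.CorCM.GaloisQuaternionCyclicPrimeTwoSheet
import HarnessLib

/-!
# The converse model theorem for `Q₈ × C_p`: no `μ₄`-norm pair in `ℤ/p` ⟹ no annihilator

COR-CM (cell `pub-hodgecm2`), binder seat b04 (gen 29), count-neutral claim QUATERNION-CYCLIC-PRIME-DEGENERATE, part IV
(the converse of part II `CorCM/GaloisQuaternionCyclicPrimeNormPairs`, on the lemmas of
`CorCM/GaloisCyclicSemidirectEightNormPairCoefficients`).  KERNEL ONLY: theorems; no definition, no named fact, no `sorry`.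
`HC_CM` is neither used nor claimed.

Part I (`CorCM/GaloisQuaternionCyclicPrimeTwoSheet`) proved the model theorem of `Q₈ × C_p` under the FIELD hypothesis «`−1`
is not a sum of two squares in a subfield containing `μ_p`» (true iff `ord_p 2` is odd); part II proved that a `μ₄`-NORM PAIR
of `Q₈ × C_p` in `ℤ/p` (sheets `k₀, k₁ : ℤ/p → ℤ/4` whose counts `Mⱼ(d,r) = #{v : kⱼ(v) − kⱼ(d − v) = r}` satisfy the two
balance identities, `k₀` non-constant) produces a primitive DEGENERATE type.
**`eq_zero_of_annihilated_quaternion_cyclic_of_forall_normPair_const`** closes the circle: if NO such pair exists, every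
`c₀`-antisymmetric function annihilated by the right translates of a CM set `S` (of which `(1, 4)` is not a left
stabiliser) vanishes.  The block of an odd character `χ = ψ_α ⊗ ψ_β` (`α = ±i`; `θ` inverts the `ℤ/4`-factor, so
`Ŝⱼ(χθ) = (1 − α)·Gⱼ^τ(β)` with `Gⱼ^τ(β) = Σ_v α^{−kⱼ(v)} β^v`) is `2·(G₀(β)G₀^τ(β) + G₁(β)G₁^τ(β))`:
* §1 `sheet_mul_sheet_tau` (`G G^τ = Σ_d C(d) β^d`, `C(d) = Σ_v α^{k(v) − k(d−v)}`), **`sum_psi_norm_ne`** (`β = 1`: the block is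
  `X₀² + Y₀² + X₁² + Y₁²` with `X₁ + Y₁` odd), **`normPair_of_det_eq_zero`** (`β` primitive: a singular block is a norm pair, by
  the `ℚ(i)`-independence of the `p`-th roots of unity, `CorCM/CyclotomicGaussianIndependence`);
* §2 the model theorem: `k₀` constant ⟹ `G₀(β) = 0` ⟹ `G₁(β)G₁^τ(β) = 0` ⟹ `k₁` constant ⟹ `C_p` stabilises `S`.

## References

* [Kubota1965] T. Kubota, *On the field extension by complex multiplication*, Trans. AMS 118 (1965), §4 Lemma 2.
* [Dodson1984] B. Dodson, *The structure of Galois groups of CM-fields*, Trans. AMS 283 (1984), §5.3.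
* [Washington1997] L. C. Washington, *Introduction to Cyclotomic Fields*, 2nd ed., GTM 83, Thm. 2.5.
-/

noncomputable section

open scoped BigOperators

namespace Summit.HodgeConjecture.CorCM.GaloisQuaternionCyclic

open Summit.HodgeConjecture.CorCM.CyclotomicGaussian (eq_of_sum_gaussian_mul_pow_eq_zero)
open Summit.HodgeConjecture.CorCM.GaloisCyclicSemidirectEight (sheet_of_cm exists_sign_of_mul_self_eq_neg_one alpha_mul_self
  alpha_pow_four eq_zero_of_int_add_int_mul_alpha psi_eq_coord eq_of_coord_eq coord_add_coord_odd character_eq_mul_pow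
  character_snd_pow_eq_one sum_psi_eq_coord const_of_sheet_sum_eq_zero sheet_mul_sheet_tau coord_neg)
open AddChar
open Multiplicative (ofAdd toAdd)

/-! ## §1 Sheet sums of `Q₈ × C_p`: the twisted expansion, the trivial block, «singular block ⟹ norm pair» -/

section Sheets

variable {p : ℕ} [Fact p.Prime]

/-- **The block of the character trivial on `ℤ/p` is never singular**: `G₀(1)G₀^τ(1) + G₁(1)G₁^τ(1) = X₀² + Y₀² + X₁² + Y₁²`
with `Xⱼ + Yⱼ` odd. [cite: Kubota1965, §4 Lemma 2] -/
theorem sum_psi_norm_ne (hp2 : p ≠ 2) {α : ℂ} {ε : ℤ} (hε : ε = 1 ∨ ε = -1) (hα : α = ε * Complex.I)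
    (k₀ k₁ : ZMod p → ZMod (2 * 2)) :
    (∑ v : ZMod p, zmodChar (2 * 2) (alpha_pow_four hε hα) (k₀ v)) *
        (∑ v : ZMod p, zmodChar (2 * 2) (alpha_pow_four hε hα) (-k₀ v)) +
      (∑ v : ZMod p, zmodChar (2 * 2) (alpha_pow_four hε hα) (k₁ v)) *
        (∑ v : ZMod p, zmodChar (2 * 2) (alpha_pow_four hε hα) (-k₁ v)) ≠ 0 := by
  have hp : p.Prime := Fact.out
  haveI : NeZero p := ⟨hp.ne_zero⟩
  have hαα : α * α = -1 := alpha_mul_self hε hα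
  have hneg : ∀ k : ZMod p → ZMod (2 * 2), ∑ v : ZMod p, zmodChar (2 * 2) (alpha_pow_four hε hα) (-k v) =
      ((∑ v : ZMod p, ((if k v = 0 then 1 else 0) - (if k v = 2 then 1 else 0) : ℤ) : ℤ) : ℂ) -
        ((∑ v : ZMod p, ((if k v = 1 then 1 else 0) - (if k v = 3 then 1 else 0) : ℤ) : ℤ) : ℂ) * α := fun k => by
    rw [sum_psi_eq_coord _ hαα (fun v => -k v)]
    have ea : (∑ v : ZMod p, ((if -k v = 0 then 1 else 0) - (if -k v = 2 then 1 else 0) : ℤ)) =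
        ∑ v : ZMod p, ((if k v = 0 then 1 else 0) - (if k v = 2 then 1 else 0) : ℤ) :=
      Finset.sum_congr rfl fun v _ => (coord_neg (k v)).1
    have eb : (∑ v : ZMod p, ((if -k v = 1 then 1 else 0) - (if -k v = 3 then 1 else 0) : ℤ)) =
        -∑ v : ZMod p, ((if k v = 1 then 1 else 0) - (if k v = 3 then 1 else 0) : ℤ) := by
      rw [← Finset.sum_neg_distrib]; exact Finset.sum_congr rfl fun v _ => (coord_neg (k v)).2
    rw [ea, eb]; push_cast; ring
  rw [sum_psi_eq_coord _ hαα k₀, sum_psi_eq_coord _ hαα k₁, hneg k₀, hneg k₁]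
  set X₀ : ℤ := ∑ v : ZMod p, ((if k₀ v = 0 then 1 else 0) - (if k₀ v = 2 then 1 else 0) : ℤ)
  set Y₀ : ℤ := ∑ v : ZMod p, ((if k₀ v = 1 then 1 else 0) - (if k₀ v = 3 then 1 else 0) : ℤ)
  set X₁ : ℤ := ∑ v : ZMod p, ((if k₁ v = 0 then 1 else 0) - (if k₁ v = 2 then 1 else 0) : ℤ)
  set Y₁ : ℤ := ∑ v : ZMod p, ((if k₁ v = 1 then 1 else 0) - (if k₁ v = 3 then 1 else 0) : ℤ)
  have hodd : ((X₁ + Y₁ : ℤ) : ZMod 2) = 1 := by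
    have h1 : ((X₁ + Y₁ : ℤ) : ZMod 2) = ∑ v : ZMod p, (1 : ZMod 2) := by
      rw [← Finset.sum_add_distrib, Int.cast_sum]
      exact Finset.sum_congr rfl fun v _ => coord_add_coord_odd (k₁ v)
    rw [h1, Finset.sum_const, Finset.card_univ, ZMod.card, nsmul_eq_mul, mul_one, ZMod.natCast_eq_one_iff_odd]
    exact hp.odd_of_ne_two hp2
  intro h
  have h' : ((X₀ ^ 2 + Y₀ ^ 2 + X₁ ^ 2 + Y₁ ^ 2 : ℤ) : ℂ) + ((0 : ℤ) : ℂ) * α = 0 := by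
    push_cast
    linear_combination h + ((Y₀ : ℂ) ^ 2 + (Y₁ : ℂ) ^ 2) * hαα
  obtain ⟨h2, -⟩ := eq_zero_of_int_add_int_mul_alpha hε hα h'
  have hX : X₁ = 0 := by nlinarith [sq_nonneg X₀, sq_nonneg Y₀, sq_nonneg X₁, sq_nonneg Y₁]
  have hY : Y₁ = 0 := by nlinarith [sq_nonneg X₀, sq_nonneg Y₀, sq_nonneg X₁, sq_nonneg Y₁]
  rw [hX, hY] at hodd
  norm_num at hodd

/-- **A singular block at a character non-trivial on `ℤ/p` is a `μ₄`-norm pair of `Q₈ × C_p`**: if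
`G₀(β)G₀^τ(β) + G₁(β)G₁^τ(β) = 0` with `β` a PRIMITIVE `p`-th root of unity, the two balance identities of
`CorCM/GaloisQuaternionCyclicPrimeNormPairs` hold (coefficient of `β^d` constant in `d` by `ℚ(i)`-independence).
[cite: Kubota1965, §4 Lemma 2] [cite: Washington1997, Thm. 2.5] -/
theorem normPair_of_det_eq_zero (hp2 : p ≠ 2) {α : ℂ} {ε : ℤ} (hε : ε = 1 ∨ ε = -1) (hα : α = ε * Complex.I)
    {β : ℂ} (hβ : IsPrimitiveRoot β p) (k₀ k₁ : ZMod p → ZMod (2 * 2))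
    (h : (∑ v : ZMod p, zmodChar (2 * 2) (alpha_pow_four hε hα) (k₀ v) * zmodChar p hβ.pow_eq_one v) *
          (∑ v : ZMod p, zmodChar (2 * 2) (alpha_pow_four hε hα) (-k₀ v) * zmodChar p hβ.pow_eq_one v) +
        (∑ v : ZMod p, zmodChar (2 * 2) (alpha_pow_four hε hα) (k₁ v) * zmodChar p hβ.pow_eq_one v) *
          (∑ v : ZMod p, zmodChar (2 * 2) (alpha_pow_four hε hα) (-k₁ v) * zmodChar p hβ.pow_eq_one v) = 0) :
    (∀ d : ZMod p,
      (Finset.univ.filter fun v => k₀ v - k₀ (d - v) = 0).card +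
            (Finset.univ.filter fun v => k₁ v - k₁ (d - v) = 0).card +
          (Finset.univ.filter fun v => k₀ v - k₀ (0 - v) = 2).card + (Finset.univ.filter fun v => k₁ v - k₁ (0 - v) = 2).card =
        (Finset.univ.filter fun v => k₀ v - k₀ (0 - v) = 0).card + (Finset.univ.filter fun v => k₁ v - k₁ (0 - v) = 0).card +
            (Finset.univ.filter fun v => k₀ v - k₀ (d - v) = 2).card +
          (Finset.univ.filter fun v => k₁ v - k₁ (d - v) = 2).card) ∧
    (∀ d : ZMod p,
      (Finset.univ.filter fun v => k₀ v - k₀ (d - v) = 1).card +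
            (Finset.univ.filter fun v => k₁ v - k₁ (d - v) = 1).card +
          (Finset.univ.filter fun v => k₀ v - k₀ (0 - v) = 3).card + (Finset.univ.filter fun v => k₁ v - k₁ (0 - v) = 3).card =
        (Finset.univ.filter fun v => k₀ v - k₀ (0 - v) = 1).card + (Finset.univ.filter fun v => k₁ v - k₁ (0 - v) = 1).card +
            (Finset.univ.filter fun v => k₀ v - k₀ (d - v) = 3).card +
          (Finset.univ.filter fun v => k₁ v - k₁ (d - v) = 3).card) := by
  classical
  have hp : p.Prime := Fact.out
  haveI : NeZero p := ⟨hp.ne_zero⟩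
  have hαα : α * α = -1 := alpha_mul_self hε hα
  set ψ4 := zmodChar (2 * 2) (alpha_pow_four hε hα) with hψ4_def
  set ψp := zmodChar p hβ.pow_eq_one with hψp_def
  set a : ZMod (2 * 2) → ℤ := fun s => (if s = 0 then 1 else 0) - (if s = 2 then 1 else 0) with ha_def
  set b : ZMod (2 * 2) → ℤ := fun s => (if s = 1 then 1 else 0) - (if s = 3 then 1 else 0) with hb_def
  set R : ZMod p → ℤ := fun d => ∑ v, a (k₀ v - k₀ (d - v)) + ∑ v, a (k₁ v - k₁ (d - v)) with hR_def
  set I : ZMod p → ℤ := fun d => ∑ v, b (k₀ v - k₀ (d - v)) + ∑ v, b (k₁ v - k₁ (d - v)) with hI_def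
  have hcoef : ∀ d : ZMod p, (∑ v : ZMod p, ψ4 (k₀ v - k₀ (d - v))) + (∑ v : ZMod p, ψ4 (k₁ v - k₁ (d - v))) =
      (R d : ℂ) + (I d : ℂ) * α := fun d => by
    rw [hψ4_def, sum_psi_eq_coord _ hαα, sum_psi_eq_coord _ hαα]
    simp only [hR_def, hI_def, ha_def, hb_def, Int.cast_add]
    ring
  have hsum : ∑ d : ZMod p, ((R d : ℂ) + ((ε * I d : ℤ) : ℂ) * Complex.I) * β ^ d.val = 0 := by
    rw [sheet_mul_sheet_tau, sheet_mul_sheet_tau, ← Finset.sum_add_distrib] at h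
    rw [← h]
    refine Finset.sum_congr rfl fun d _ => ?_
    rw [hψp_def, zmodChar_apply, ← add_mul, hcoef d, hα]
    push_cast
    ring
  obtain ⟨hR, hI⟩ := eq_of_sum_gaussian_mul_pow_eq_zero hp2 hβ R (fun d => ε * I d) hsum
  have hε0 : ε ≠ 0 := by rcases hε with rfl | rfl <;> norm_num
  have hI' : ∀ d, I d = I 0 := fun d => mul_left_cancel₀ hε0 (hI d)
  have hcardA : ∀ (k : ZMod p → ZMod (2 * 2)) (d : ZMod p), ∑ v, a (k v - k (d - v)) =
      ((Finset.univ.filter fun v => k v - k (d - v) = 0).card : ℤ) -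
        ((Finset.univ.filter fun v => k v - k (d - v) = 2).card : ℤ) := fun k d => by
    simp only [ha_def, Finset.sum_sub_distrib, Finset.sum_boole]
  have hcardB : ∀ (k : ZMod p → ZMod (2 * 2)) (d : ZMod p), ∑ v, b (k v - k (d - v)) =
      ((Finset.univ.filter fun v => k v - k (d - v) = 1).card : ℤ) -
        ((Finset.univ.filter fun v => k v - k (d - v) = 3).card : ℤ) := fun k d => by
    simp only [hb_def, Finset.sum_sub_distrib, Finset.sum_boole]
  refine ⟨fun d => ?_, fun d => ?_⟩
  · have h1 := hR d
    simp only [hR_def, hcardA] at h1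
    omega
  · have h1 := hI' d
    simp only [hI_def, hcardB] at h1
    omega

end Sheets


/-! ## §2 The converse model theorem for `Q₈ × C_p` -/

section Model

variable {p : ℕ} [Fact p.Prime]

/-- **THE CONVERSE MODEL THEOREM for `Q₈ × C_p`.**  `p` an odd prime.  Suppose `ℤ/p` carries NO `μ₄`-norm pair of
`Q₈ × C_p` with non-constant first sheet: for all `k₀, k₁ : ℤ/p → ℤ/4` the two balance identities of
`CorCM/GaloisQuaternionCyclicPrimeNormPairs` force `k₀` to be constant (`hNP`).  If `S ⊆ Q₈ × C_p` is a CM set for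
`c₀ = (a 2, 1)` and `(1, 4)` is not a left stabiliser of `S`, then every `c₀`-antisymmetric `b : Q₈ × C_p → ℚ` annihilated by
all right translates of `S` is zero.  (Block of `χ = ψ_α ⊗ ψ_β`: `2(G₀(β)G₀^τ(β) + G₁(β)G₁^τ(β))`; `β = 1`: a sum of four
integer squares with `X₁ + Y₁` odd; `β ≠ 1`: a singular block is a norm pair, so `k₀` is constant, `G₀(β) = 0` kills
`G₁(β)G₁^τ(β)`, `k₁` is constant, and `C_p` stabilises `S`.) [cite: Kubota1965, §4 Lemma 2] [cite: Washington1997, Thm. 2.5] -/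
theorem eq_zero_of_annihilated_quaternion_cyclic_of_forall_normPair_const (hp2 : p ≠ 2)
    (hNP : ∀ k₀ k₁ : ZMod p → ZMod 4,
      (∀ d : ZMod p,
        (Finset.univ.filter fun v => k₀ v - k₀ (d - v) = 0).card +
              (Finset.univ.filter fun v => k₁ v - k₁ (d - v) = 0).card +
            (Finset.univ.filter fun v => k₀ v - k₀ (0 - v) = 2).card +
              (Finset.univ.filter fun v => k₁ v - k₁ (0 - v) = 2).card =
          (Finset.univ.filter fun v => k₀ v - k₀ (0 - v) = 0).card +
                (Finset.univ.filter fun v => k₁ v - k₁ (0 - v) = 0).card +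
              (Finset.univ.filter fun v => k₀ v - k₀ (d - v) = 2).card +
            (Finset.univ.filter fun v => k₁ v - k₁ (d - v) = 2).card) →
      (∀ d : ZMod p,
        (Finset.univ.filter fun v => k₀ v - k₀ (d - v) = 1).card +
              (Finset.univ.filter fun v => k₁ v - k₁ (d - v) = 1).card +
            (Finset.univ.filter fun v => k₀ v - k₀ (0 - v) = 3).card +
              (Finset.univ.filter fun v => k₁ v - k₁ (0 - v) = 3).card =
          (Finset.univ.filter fun v => k₀ v - k₀ (0 - v) = 1).card +
                (Finset.univ.filter fun v => k₁ v - k₁ (0 - v) = 1).card +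
              (Finset.univ.filter fun v => k₀ v - k₀ (d - v) = 3).card +
            (Finset.univ.filter fun v => k₁ v - k₁ (d - v) = 3).card) →
      ∀ v, k₀ v = k₀ 0)
    (S : Finset (QuaternionGroup 2 × Multiplicative (ZMod p)))
    (hScm : ∀ y : QuaternionGroup 2 × Multiplicative (ZMod p), (QuaternionGroup.a 2, 1) * y ∈ S ↔ y ∉ S)
    (hstab : ¬ ∀ w : QuaternionGroup 2 × Multiplicative (ZMod p),
      w ∈ S ↔ ((1 : QuaternionGroup 2), Multiplicative.ofAdd (4 : ZMod p)) * w ∈ S)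
    (b : QuaternionGroup 2 × Multiplicative (ZMod p) → ℚ) (hb : ∀ g, b ((QuaternionGroup.a 2, 1) * g) = -b g)
    (hann : ∀ g, ∑ s ∈ S, b (s * g) = 0) : b = 0 := by
  classical
  have hp : p.Prime := Fact.out
  haveI : NeZero p := ⟨hp.ne_zero⟩
  haveI : Fact (1 < p) := ⟨hp.one_lt⟩
  -- ===== the two-sheet structure of `Q₈ × C_p` (as in part I `CorCM/GaloisQuaternionCyclicPrimeTwoSheet`) =====
  let i₁ : Multiplicative (ZMod (2 * 2)) →* QuaternionGroup 2 :=
    MonoidHom.mk' (fun u => QuaternionGroup.a (Multiplicative.toAdd u)) fun u v => by simp [toAdd_mul]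
  let i : Multiplicative (ZMod (2 * 2)) × Multiplicative (ZMod p) →* QuaternionGroup 2 × Multiplicative (ZMod p) :=
    MonoidHom.prodMap i₁ (MonoidHom.id _)
  have hi_apply : ∀ u v, i (u, v) = (QuaternionGroup.a (Multiplicative.toAdd u), v) := fun u v => rfl
  have hi : Function.Injective i := by
    rintro ⟨u, v⟩ ⟨u', v'⟩ h
    simp only [hi_apply, Prod.mk.injEq, QuaternionGroup.a.injEq] at h
    exact Prod.ext (by simpa using h.1) h.2
  have hx : ∀ w, i w ≠ (QuaternionGroup.xa 0, 1) := fun ⟨u, v⟩ => by simp [hi_apply]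
  have hcov : ∀ g : QuaternionGroup 2 × Multiplicative (ZMod p),
      (∃ w, g = i w) ∨ (∃ w, g = i w * (QuaternionGroup.xa 0, 1)) := by
    rintro ⟨j | j, v⟩
    · exact Or.inl ⟨(Multiplicative.ofAdd j, v), by simp [hi_apply]⟩
    · exact Or.inr ⟨(Multiplicative.ofAdd (-j), v), by simp [hi_apply]⟩
  let θ : Multiplicative (ZMod (2 * 2)) × Multiplicative (ZMod p) ≃*
      Multiplicative (ZMod (2 * 2)) × Multiplicative (ZMod p) :=
    MulEquiv.prodCongr (MulEquiv.inv _) (MulEquiv.refl _)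
  have hθ_apply : ∀ w, θ w = (w.1⁻¹, w.2) := fun w => rfl
  have hθ : ∀ w, ((QuaternionGroup.xa 0, 1) : QuaternionGroup 2 × Multiplicative (ZMod p)) * i w =
      i (θ w) * (QuaternionGroup.xa 0, 1) := fun ⟨u, v⟩ => by simp [hi_apply, hθ_apply]
  set c : Multiplicative (ZMod (2 * 2)) × Multiplicative (ZMod p) := (Multiplicative.ofAdd 2, 1) with hc_def
  have hic : i c = (QuaternionGroup.a 2, 1) := rfl
  have hxx : ((QuaternionGroup.xa 0, 1) : QuaternionGroup 2 × Multiplicative (ZMod p)) * (QuaternionGroup.xa 0, 1) =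
      i c := by
    rw [hic, Prod.mk_mul_mk, QuaternionGroup.xa_mul_xa, mul_one]
    norm_num
  have h22 : (2 : ZMod (2 * 2)) + 2 = 0 := by decide
  have hcc : c * c = 1 := by
    rw [hc_def, Prod.mk_mul_mk, mul_one, ← ofAdd_add, h22]; rfl
  have hθc : θ c = c := by
    rw [hθ_apply, hc_def]
    refine Prod.ext ?_ rfl
    change Multiplicative.ofAdd (-(2 : ZMod (2 * 2))) = Multiplicative.ofAdd 2
    rw [neg_eq_of_add_eq_zero_left h22]
  set S₁ : Finset (Multiplicative (ZMod (2 * 2)) × Multiplicative (ZMod p)) :=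
    Finset.univ.filter fun w => i w ∈ S with hS₁_def
  set S₂ : Finset (Multiplicative (ZMod (2 * 2)) × Multiplicative (ZMod p)) :=
    Finset.univ.filter fun w => i w * (QuaternionGroup.xa 0, 1) ∈ S with hS₂_def
  have hS₁ : ∀ w, w ∈ S₁ ↔ i w ∈ S := fun w => by simp [hS₁_def]
  have hS₂ : ∀ w, w ∈ S₂ ↔ i w * (QuaternionGroup.xa 0, 1) ∈ S := fun w => by simp [hS₂_def]
  have hS₁c : ∀ w, c * w ∈ S₁ ↔ w ∉ S₁ := fun w => by rw [hS₁, hS₁, map_mul, hic, hScm]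
  have hS₂c : ∀ w, c * w ∈ S₂ ↔ w ∉ S₂ := fun w => by rw [hS₂, hS₂, map_mul, hic, mul_assoc, hScm]
  have h40 : (4 : ZMod (2 * 2)) = 0 := by decide
  set γ4 : Multiplicative (ZMod (2 * 2)) × Multiplicative (ZMod p) :=
    ((1 : Multiplicative (ZMod (2 * 2))), Multiplicative.ofAdd (4 : ZMod p)) with hγ4_def
  have hγ4 : i γ4 = ((1 : QuaternionGroup 2), Multiplicative.ofAdd (4 : ZMod p)) := by
    rw [hγ4_def, hi_apply, toAdd_one, QuaternionGroup.one_def]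
  have hcomm : ∀ w, i γ4 * i w = i (w * γ4) := fun w => by rw [← map_mul, mul_comm w]
  -- ===== the sheets `k₀, k₁` of `S` =====
  have hex : ∀ (T : Finset (Multiplicative (ZMod (2 * 2)) × Multiplicative (ZMod p)))
      (hT : ∀ w, c * w ∈ T ↔ w ∉ T) (x : ZMod p),
      ∃ k : ZMod (2 * 2), ∀ t : ZMod (2 * 2), (ofAdd t, ofAdd x) ∈ T ↔ (t = k ∨ t = k + 1) := fun T hT x => by
    refine sheet_of_cm _ fun t => ?_
    have h := hT (ofAdd t, ofAdd x)
    rwa [hc_def, Prod.mk_mul_mk, one_mul, ← ofAdd_add, add_comm] at h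
  choose k₀ hk₀ using hex S₁ hS₁c
  choose k₁ hk₁ using hex S₂ hS₂c
  have hmem₀ : ∀ w : Multiplicative (ZMod (2 * 2)) × Multiplicative (ZMod p),
      w ∈ S₁ ↔ (toAdd w.1 = k₀ (toAdd w.2) ∨ toAdd w.1 = k₀ (toAdd w.2) + 1) := fun ⟨t, x⟩ => by
    have h := hk₀ (toAdd x) (toAdd t); rwa [ofAdd_toAdd, ofAdd_toAdd] at h
  have hmem₁ : ∀ w : Multiplicative (ZMod (2 * 2)) × Multiplicative (ZMod p),
      w ∈ S₂ ↔ (toAdd w.1 = k₁ (toAdd w.2) ∨ toAdd w.1 = k₁ (toAdd w.2) + 1) := fun ⟨t, x⟩ => by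
    have h := hk₁ (toAdd x) (toAdd t); rwa [ofAdd_toAdd, ofAdd_toAdd] at h
  set gr : (ZMod p → ZMod (2 * 2)) → Finset (Multiplicative (ZMod (2 * 2)) × Multiplicative (ZMod p)) := fun k =>
    Finset.univ.map ⟨fun v => (ofAdd (k v), ofAdd v), fun v w h => by simpa using congrArg Prod.snd h⟩ with hgr_def
  have hgr : ∀ (k : ZMod p → ZMod (2 * 2)) (t : Multiplicative (ZMod (2 * 2))) (x : Multiplicative (ZMod p)),
      (t, x) ∈ gr k ↔ toAdd t = k (toAdd x) := fun k t x => by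
    simp only [hgr_def, Finset.mem_map, Finset.mem_univ, true_and, Function.Embedding.coeFn_mk, Prod.mk.injEq]
    constructor
    · rintro ⟨w, h1, h2⟩
      rw [← h1, ← h2, toAdd_ofAdd, toAdd_ofAdd]
    · intro h
      exact ⟨toAdd x, by rw [← h, ofAdd_toAdd], ofAdd_toAdd x⟩
  have hgr_sum : ∀ (k : ZMod p → ZMod (2 * 2)) (g : Multiplicative (ZMod (2 * 2)) × Multiplicative (ZMod p) → ℂ),
      ∑ w ∈ gr k, g w = ∑ v : ZMod p, g (ofAdd (k v), ofAdd v) := fun k g => by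
    rw [hgr_def, Finset.sum_map]; rfl
  have h1ne : ∀ k : ZMod (2 * 2), k ≠ k + 1 := by decide
  have hgr_disj : ∀ k : ZMod p → ZMod (2 * 2), Disjoint (gr k) (gr fun v => k v + 1) := fun k => by
    rw [Finset.disjoint_left]
    rintro ⟨t, x⟩ h1 h2
    rw [hgr] at h1 h2
    exact h1ne _ (h1.symm.trans h2)
  have hS₁gr : S₁ = gr k₀ ∪ gr (fun v => k₀ v + 1) := by
    ext ⟨t, x⟩; rw [hmem₀, Finset.mem_union, hgr, hgr]
  have hS₂gr : S₂ = gr k₁ ∪ gr (fun v => k₁ v + 1) := by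
    ext ⟨t, x⟩; rw [hmem₁, Finset.mem_union, hgr, hgr]
  -- ===== the determinant never vanishes on odd characters =====
  have hdet : ∀ χ : AddChar (Additive (Multiplicative (ZMod (2 * 2)) × Multiplicative (ZMod p))) ℂ,
      χ (Additive.ofMul c) = -1 →
      (∑ s ∈ S₁, χ (Additive.ofMul s)) * (∑ s ∈ S₁, χ (Additive.ofMul (θ s))) -
        χ (Additive.ofMul c) * ((∑ t ∈ S₂, χ (Additive.ofMul t)) * (∑ t ∈ S₂, χ (Additive.ofMul (θ t)))) ≠ 0 := by
    intro χ hχ hΔ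
    simp_rw [hθ_apply] at hΔ
    rw [hχ] at hΔ
    set α : ℂ := χ (Additive.ofMul (ofAdd (1 : ZMod (2 * 2)), (1 : Multiplicative (ZMod p)))) with hα_def
    set β : ℂ := χ (Additive.ofMul ((1 : Multiplicative (ZMod (2 * 2))), ofAdd (1 : ZMod p))) with hβ_def
    have hαα : α * α = -1 := omega_mul_omega χ hχ
    obtain ⟨ε, hε, hα⟩ := exists_sign_of_mul_self_eq_neg_one hαα
    have hα4 : α ^ (2 * 2) = 1 := alpha_pow_four hε hα
    have hβp : β ^ p = 1 := character_snd_pow_eq_one χ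
    set ψ4 : AddChar (ZMod (2 * 2)) ℂ := zmodChar (2 * 2) hα4 with hψ4_def
    set ψp : AddChar (ZMod p) ℂ := zmodChar p hβp with hψp_def
    have hχv : ∀ (t : Multiplicative (ZMod (2 * 2))) (x : Multiplicative (ZMod p)),
        χ (Additive.ofMul (t, x)) = ψ4 (toAdd t) * ψp (toAdd x) := fun t x => by
      rw [character_eq_mul_pow, hψ4_def, hψp_def, zmodChar_apply, zmodChar_apply]
    have h1val : (1 : ZMod (2 * 2)).val = 1 := by decide
    have hψ41 : ψ4 1 = α := by rw [hψ4_def, zmodChar_apply, h1val, pow_one]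
    have hψ43 : ψ4 (-1) = -α := by
      rw [show (-1 : ZMod (2 * 2)) = 3 by decide, hψ4_def, zmodChar_apply, show (3 : ZMod (2 * 2)).val = 3 from rfl,
        pow_succ, pow_two, hαα]; ring
    -- sheet sums `Ŝⱼ(χ) = (1 + α) Gⱼ(β)`, `Ŝⱼ(χθ) = (1 − α) Gⱼ^τ(β)`
    have hsheet : ∀ (k : ZMod p → ZMod (2 * 2)) (η : ZMod p → ℂ),
        ∑ w ∈ gr k ∪ gr (fun v => k v + 1), ψ4 (toAdd w.1) * η (toAdd w.2) =
        (1 + α) * ∑ v : ZMod p, ψ4 (k v) * η v := fun k η => by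
      rw [Finset.sum_union (hgr_disj k), hgr_sum, hgr_sum, Finset.mul_sum, ← Finset.sum_add_distrib]
      refine Finset.sum_congr rfl fun v _ => ?_
      simp only [toAdd_ofAdd]
      rw [map_add_eq_mul, hψ41]; ring
    have hsheetτ : ∀ (k : ZMod p → ZMod (2 * 2)) (η : ZMod p → ℂ),
        ∑ w ∈ gr k ∪ gr (fun v => k v + 1), ψ4 (-toAdd w.1) * η (toAdd w.2) =
        (1 - α) * ∑ v : ZMod p, ψ4 (-k v) * η v := fun k η => by
      rw [Finset.sum_union (hgr_disj k), hgr_sum, hgr_sum, Finset.mul_sum, ← Finset.sum_add_distrib]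
      refine Finset.sum_congr rfl fun v _ => ?_
      simp only [toAdd_ofAdd]
      rw [neg_add, map_add_eq_mul, hψ43]; ring
    have eA : ∑ s ∈ S₁, χ (Additive.ofMul s) = (1 + α) * ∑ v : ZMod p, ψ4 (k₀ v) * ψp v := by
      rw [hS₁gr, ← hsheet k₀ (fun v => ψp v)]
      exact Finset.sum_congr rfl fun w _ => hχv w.1 w.2
    have eAθ : ∑ s ∈ S₁, χ (Additive.ofMul (s.1⁻¹, s.2)) = (1 - α) * ∑ v : ZMod p, ψ4 (-k₀ v) * ψp v := by
      rw [hS₁gr, ← hsheetτ k₀ (fun v => ψp v)]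
      exact Finset.sum_congr rfl fun w _ => by rw [hχv, toAdd_inv]
    have eB : ∑ s ∈ S₂, χ (Additive.ofMul s) = (1 + α) * ∑ v : ZMod p, ψ4 (k₁ v) * ψp v := by
      rw [hS₂gr, ← hsheet k₁ (fun v => ψp v)]
      exact Finset.sum_congr rfl fun w _ => hχv w.1 w.2
    have eBθ : ∑ s ∈ S₂, χ (Additive.ofMul (s.1⁻¹, s.2)) = (1 - α) * ∑ v : ZMod p, ψ4 (-k₁ v) * ψp v := by
      rw [hS₂gr, ← hsheetτ k₁ (fun v => ψp v)]
      exact Finset.sum_congr rfl fun w _ => by rw [hχv, toAdd_inv]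
    -- the core identity `G₀G₀^τ + G₁G₁^τ = 0`
    have hα0 : α ≠ 0 := fun h => by rw [h, mul_zero] at hαα; norm_num at hαα
    have h2 : (1 + α) * (1 - α) ≠ 0 := by
      rw [show (1 + α) * (1 - α) = 2 by linear_combination (-1 : ℂ) * hαα]; exact two_ne_zero
    have hcore : (∑ v : ZMod p, ψ4 (k₀ v) * ψp v) * (∑ v : ZMod p, ψ4 (-k₀ v) * ψp v) +
        (∑ v : ZMod p, ψ4 (k₁ v) * ψp v) * (∑ v : ZMod p, ψ4 (-k₁ v) * ψp v) = 0 := by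
      rw [eA, eAθ, eB, eBθ] at hΔ
      have h : (1 + α) * (1 - α) * ((∑ v : ZMod p, ψ4 (k₀ v) * ψp v) * (∑ v : ZMod p, ψ4 (-k₀ v) * ψp v) +
          (∑ v : ZMod p, ψ4 (k₁ v) * ψp v) * (∑ v : ZMod p, ψ4 (-k₁ v) * ψp v)) = 0 := by
        linear_combination hΔ
      exact (mul_eq_zero.1 h).resolve_left h2
    by_cases hβ1 : β = 1
    · have hψp1 : ∀ v : ZMod p, ψp v = 1 := fun v => by rw [hψp_def, zmodChar_apply, hβ1, one_pow]
      simp only [hψp1, mul_one] at hcore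
      exact sum_psi_norm_ne hp2 hε hα k₀ k₁ hcore
    · have hβprim : IsPrimitiveRoot β p := (IsPrimitiveRoot.iff_orderOf).2 (orderOf_eq_prime hβp hβ1)
      obtain ⟨hR, hI⟩ := normPair_of_det_eq_zero hp2 hε hα hβprim k₀ k₁ hcore
      have hk₀c : ∀ v, k₀ v = k₀ 0 := hNP k₀ k₁ hR hI
      have hψp_ne : ψp ≠ 1 := by
        intro h
        have h1 : ψp 1 = 1 := by rw [h, AddChar.one_apply]
        rw [hψp_def, zmodChar_apply, ZMod.val_one, pow_one] at h1
        exact hβ1 h1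
      have hA₀ : ∑ v : ZMod p, ψ4 (k₀ v) * ψp v = 0 := by
        simp_rw [hk₀c]
        rw [← Finset.mul_sum, AddChar.sum_eq_zero_of_ne_one hψp_ne, mul_zero]
      rw [hA₀, zero_mul, zero_add] at hcore
      have hk₁c : ∀ v, k₁ v = k₁ 0 := by
        rcases mul_eq_zero.1 hcore with h | h
        · exact const_of_sheet_sum_eq_zero hp2 hε hα hβprim k₁ h
        · have hc := const_of_sheet_sum_eq_zero hp2 hε hα hβprim (fun v => -k₁ v) h
          intro v
          exact neg_inj.1 (hc v)
      apply hstab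
      intro w
      rw [← hγ4]
      rcases hcov w with ⟨u, rfl⟩ | ⟨u, rfl⟩
      · rw [← hS₁, hcomm, ← hS₁, hmem₀, hmem₀, hγ4_def, Prod.snd_mul, Prod.fst_mul, mul_one, hk₀c (toAdd u.2),
          hk₀c (toAdd (u.2 * _))]
      · rw [← hS₂, ← mul_assoc, hcomm, ← hS₂, hmem₁, hmem₁, hγ4_def, Prod.snd_mul, Prod.fst_mul, mul_one,
          hk₁c (toAdd u.2), hk₁c (toAdd (u.2 * _))]
  exact TwoSheet.eq_zero_of_twoSheet i hi (QuaternionGroup.xa 0, 1) hx hcov θ hθ c hxx hcc hθc S S₁ S₂ hS₁ hS₂ hdet b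
    (fun g => by rw [hic]; exact hb g) hann

end Model

end Summit.HodgeConjecture.CorCM.GaloisQuaternionCyclic

end
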